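import Summits.ValiantsHypothesis.ValiantsHypothesis.Theorems.NisanPermanent
import HarnessLib

/-!
# Nisan's rank bound for the ORDERED (Cayley) DETERMINANT: nc-ABP width `= C(n,⌊n/2⌋)` too (kernel)

Decomposition workshop `decomp-valiant`, lens 6 «restricted-models lifting axis», gen 4, node
`CommutativityDial`: a DECIDED datum for the RESIDUAL side. The node's residual `B_nc = NcLift` asks,
under `VP = VNP`, for poly-size NONCOMMUTATIVE CIRCUITS for the ordered permanent, and its cheapest
concrete face is «is the Cayley determinant nc-circuit-easy?» (Arvind–Srinivasan 2010: nc circuits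
for the Cayley determinant of polynomial size would give such circuits for the Cayley permanent). This
file records, in the kernel, that ONE MODEL DOWN the question is DECIDED NEGATIVELY and is BLIND TO
`VP` VERSUS `VNP`: Nisan's matrix of the determinant's word tensor
`detWord n (w) = sign(w)·[w is a permutation]` has rank EXACTLY `C(n,a)` at every cut `a | n-a`, the same
as the permanent's (`NisanPermanent.rank_wordFlattening_perWord`), hence

* `hasNcABPWidthLE_detWord_iff : BDI2020.HasNcABPWidthLE w (detWord F n) ↔ C(n,⌊n/2⌋) ≤ w`,
* `ncAbpWidth_detWord : BDI2020.ncAbpWidth (detWord F n) = C(n,⌊n/2⌋) = ncAbpWidth (perWord F n)`.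

So the restricted-models axis below circuits (nc formulas ⊂ nc ABPs) cannot host the lifting residual:
a `VP` family (det) is exactly as hard there as the `VNP`-complete one; any `B_nc`-type statement must
use genuine circuit power (cf. HWY10 Thm 1.7's `SOS` road on the hardness side).

PROOF: the row of an injective prefix `u` with letter set `S` is `sign(π_u) · R_S`, where `R_S` is the
row of the increasing enumeration of `S` and `π_u` sorts `u` (`wordSign_comp_perm`, block permutation
`blockPerm`), so the row space is spanned by the `C(n,a)` rows `R_S`; these are linearly independent
because `R_S` is `±1` at the increasing enumeration of `Sᶜ` and `R_{S'}` vanishes there (`S' ≠ S`).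

HONEST FRAMING: Nisan 1991 (Thm 1, for det as for per) re-typed over the tree's `wordFlattening` /
`BDI2020.HasNcABPWidthLE`; nothing here bears on `VP ≠ VNP`.

## References
* [Nisan1991Noncommutative] N. Nisan, Lower bounds for non-commutative computation, STOC 1991, Thm 1, §4.
* [ArvindSrinivasan2010] V. Arvind, S. Srinivasan, On the hardness of the noncommutative determinant,
  STOC 2010 (arXiv:0910.2370).
* [BlaserDorflerIkenmeyer2020] M. Bläser, J. Dörfler, C. Ikenmeyer, arXiv:2011.04778, Prop 12.
-/

namespace Summit.ValiantsHypothesis.ValiantsHypothesis.Theorems.NisanDeterminant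

open Literature.Computability.AlgebraicComplexity
open Summit.ValiantsHypothesis.ValiantsHypothesis.Theorems.NisanPermanent

variable (F : Type*) [Field F]

/-! ## §1 The signed word tensor of the Cayley determinant -/

/-- The SIGN OF A WORD: `sign(t ↦ w t)` if `w : Fin n → Fin n` is a permutation, else `0`.
[cite: Nisan1991Noncommutative, §4] -/
noncomputable def wordSign (n : ℕ) (w : Fin n → Fin n) : F :=
  if h : Function.Bijective w then ((Equiv.Perm.sign (Equiv.ofBijective w h) : ℤ) : F) else 0

/-- The word tensor of the ORDERED (Cayley) DETERMINANT `Σ_π sign(π) x_{π(0),0} ⋯ x_{π(n-1),n-1}` read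
as letters = rows at positions = columns: the coefficient of the word `w(0) ⋯ w(n-1)`.
[cite: Nisan1991Noncommutative, §4] -/
noncomputable def detWord (n : ℕ) : (Fin n → Fin n) → F := wordSign F n

variable {F}

/-- Precomposing a word with a permutation multiplies its sign. [folklore] -/
theorem wordSign_comp_perm {n : ℕ} (w : Fin n → Fin n) (c : Equiv.Perm (Fin n)) :
    wordSign F n (w ∘ ⇑c) = ((Equiv.Perm.sign c : ℤ) : F) * wordSign F n w := by
  unfold wordSign
  by_cases hw : Function.Bijective w
  · have hwc : Function.Bijective (w ∘ ⇑c) := hw.comp c.bijective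
    rw [dif_pos hwc, dif_pos hw]
    have e : Equiv.ofBijective (w ∘ ⇑c) hwc = Equiv.ofBijective w hw * c :=
      Equiv.ext fun x => rfl
    rw [e, Equiv.Perm.sign_mul, Units.val_mul, Int.cast_mul, mul_comm]
  · have hwc : ¬ Function.Bijective (w ∘ ⇑c) := fun h' =>
      hw ((Function.Bijective.of_comp_iff w c.bijective).mp h')
    rw [dif_neg hwc, dif_neg hw, mul_zero]

/-- A nonzero value: the sign of a permutation word is `±1 ≠ 0` in a field. [folklore] -/
theorem wordSign_ne_zero {n : ℕ} {w : Fin n → Fin n} (hw : Function.Bijective w) :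
    wordSign F n w ≠ 0 := by
  unfold wordSign
  rw [dif_pos hw]
  rcases Int.units_eq_one_or (Equiv.Perm.sign (Equiv.ofBijective w hw)) with h | h <;>
    simp [h]

/-- A non-permutation word has sign `0`. [folklore] -/
theorem wordSign_of_not_injective {n : ℕ} {w : Fin n → Fin n} (hw : ¬ Function.Injective w) :
    wordSign F n w = 0 := by
  unfold wordSign
  rw [dif_neg fun h => hw h.injective]

/-! ## §2 Sorting a prefix: block permutations -/

/-- The block permutation `π ⊕ id` of `Fin n = Fin a ⊕ Fin b` (`a + b = n`). [folklore] -/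
def blockPerm {n a b : ℕ} (h : a + b = n) (π : Equiv.Perm (Fin a)) : Equiv.Perm (Fin n) :=
  (finCongr h).permCongr (finSumFinEquiv.permCongr (Equiv.sumCongr π (Equiv.refl (Fin b))))

/-- Its sign is `sign π`. [folklore] -/
theorem sign_blockPerm {n a b : ℕ} (h : a + b = n) (π : Equiv.Perm (Fin a)) :
    Equiv.Perm.sign (blockPerm h π) = Equiv.Perm.sign π := by
  rw [blockPerm, Equiv.Perm.sign_permCongr, Equiv.Perm.sign_permCongr, Equiv.Perm.sign_sumCongr,
    Equiv.Perm.sign_refl, mul_one]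

/-- Permuting the prefix = precomposing the glued word with the block permutation. [folklore] -/
theorem append_comp_perm {n a b : ℕ} (h : a + b = n) (u : Fin a → Fin n) (π : Equiv.Perm (Fin a))
    (v : Fin b → Fin n) :
    (fun t => Fin.append (u ∘ ⇑π) v (Fin.cast h.symm t)) =
      (fun t => Fin.append u v (Fin.cast h.symm t)) ∘ ⇑(blockPerm h π) := by
  funext t
  obtain ⟨x, rfl⟩ : ∃ x : Fin (a + b), t = Fin.cast h x := ⟨Fin.cast h.symm t, Fin.ext rfl⟩
  have cc : ∀ y : Fin (a + b), Fin.cast h.symm (Fin.cast h y) = y := fun y => Fin.ext rfl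
  simp only [Function.comp_apply, blockPerm, Equiv.permCongr_apply, finCongr_symm, finCongr_apply,
    cc]
  induction x using Fin.addCases with
  | left i => simp
  | right j => simp

/-- SORTING AN INJECTIVE PREFIX: `u = (increasing enumeration of its letter set) ∘ π` for a
permutation `π` of the positions. [folklore] -/
theorem exists_perm_sort {n a : ℕ} (u : Fin a → Fin n) (hu : Function.Injective u) :
    ∃ π : Equiv.Perm (Fin a), u = (fun i => (Finset.univ.image u).orderEmbOfFin
      (by rw [Finset.card_image_of_injective _ hu, Finset.card_univ, Fintype.card_fin]) i) ∘ ⇑π := by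
  set S := Finset.univ.image u with hSdef
  have hS : S.card = a := by
    rw [hSdef, Finset.card_image_of_injective _ hu, Finset.card_univ, Fintype.card_fin]
  have hmem : ∀ i, u i ∈ S := fun i => Finset.mem_image_of_mem u (Finset.mem_univ i)
  let e := S.orderIsoOfFin hS
  let f : Fin a → Fin a := fun i => e.symm ⟨u i, hmem i⟩
  have hf : Function.Injective f := fun i j hij => hu (by
    have := congrArg (fun x : ↥S => (x : Fin n)) (e.symm.injective hij)
    exact this)
  refine ⟨Equiv.ofBijective f (Finite.injective_iff_bijective.mp hf), funext fun i => ?_⟩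
  simp only [Function.comp_apply, Equiv.ofBijective_apply]
  rw [← Finset.coe_orderIsoOfFin_apply S hS (f i)]
  simp [f, e]

/-! ## §3 Rows of Nisan's matrix of the determinant -/

/-- The row of the increasing enumeration of `S` (`|S| = a`). [cite: Nisan1991Noncommutative, §4] -/
noncomputable def sortedRow {n : ℕ} (a b : ℕ) (h : a + b = n) (S : Finset (Fin n))
    (hS : S.card = a) : (Fin b → Fin n) → F :=
  wordFlattening (detWord F n) a b h fun i => S.orderEmbOfFin hS i

/-- Every row of Nisan's matrix of the determinant is `±` a sorted row (injective prefix) or `0`.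
[cite: Nisan1991Noncommutative, §4] -/
theorem row_mem_span {n a b : ℕ} (h : a + b = n) (u : Fin a → Fin n) :
    wordFlattening (detWord F n) a b h u ∈ Submodule.span F
      (Set.range fun S : {S : Finset (Fin n) // S.card = a} => sortedRow (F := F) a b h S.1 S.2) := by
  by_cases hu : Function.Injective u
  · obtain ⟨π, hπ⟩ := exists_perm_sort u hu
    have hS : (Finset.univ.image u).card = a := by
      rw [Finset.card_image_of_injective _ hu, Finset.card_univ, Fintype.card_fin]
    have key : wordFlattening (detWord F n) a b h u =
        ((Equiv.Perm.sign π : ℤ) : F) • sortedRow (F := F) a b h (Finset.univ.image u) hS := by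
      ext v
      rw [Pi.smul_apply, smul_eq_mul, sortedRow, wordFlattening_apply, wordFlattening_apply, detWord]
      conv_lhs => rw [hπ]
      rw [append_comp_perm h _ π v, wordSign_comp_perm, sign_blockPerm]
    rw [key]
    exact Submodule.smul_mem _ _ (Submodule.subset_span ⟨⟨_, hS⟩, rfl⟩)
  · have : wordFlattening (detWord F n) a b h u = 0 := by
      ext v
      rw [wordFlattening_apply, detWord, Pi.zero_apply, wordSign_of_not_injective]
      intro hinj
      apply hu
      have h1 : Function.Injective (Fin.append u v) :=
        (Function.Injective.of_comp_iff' (Fin.append u v) (finCongr h.symm).bijective).mp hinj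
      exact (Fin.append_injective_iff.mp h1).1
    rw [this]
    exact Submodule.zero_mem _

/-- The sorted row `R_S` is `±1 ≠ 0` at the increasing enumeration of `Sᶜ`. [folklore] -/
theorem sortedRow_self {n a b : ℕ} (h : a + b = n) (S : Finset (Fin n)) (hS : S.card = a) :
    sortedRow (F := F) a b h S hS (fun t => Sᶜ.orderEmbOfFin (card_compl_eq h S hS) t) ≠ 0 := by
  rw [sortedRow, wordFlattening_apply, detWord]
  apply wordSign_ne_zero
  refine (Finite.injective_iff_bijective.mp ?_)
  refine (Function.Injective.of_comp_iff' (Fin.append (fun i => S.orderEmbOfFin hS i)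
    (fun t => Sᶜ.orderEmbOfFin (card_compl_eq h S hS) t)) (finCongr h.symm).bijective).mpr ?_
  rw [Fin.append_injective_iff]
  refine ⟨(S.orderEmbOfFin hS).injective, (Sᶜ.orderEmbOfFin _).injective, fun i j e => ?_⟩
  have h1 : S.orderEmbOfFin hS i ∈ S := Finset.orderEmbOfFin_mem S hS i
  have h2 : Sᶜ.orderEmbOfFin (card_compl_eq h S hS) j ∈ Sᶜ := Finset.orderEmbOfFin_mem _ _ j
  rw [e] at h1
  exact Finset.mem_compl.mp h2 h1

/-- The sorted row `R_{S'}` vanishes at the increasing enumeration of `Sᶜ` for `S' ≠ S` of the same size.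
[folklore] -/
theorem sortedRow_other {n a b : ℕ} (h : a + b = n) (S S' : Finset (Fin n)) (hS : S.card = a)
    (hS' : S'.card = a) (hne : S' ≠ S) :
    sortedRow (F := F) a b h S' hS' (fun t => Sᶜ.orderEmbOfFin (card_compl_eq h S hS) t) = 0 := by
  rw [sortedRow, wordFlattening_apply, detWord]
  apply wordSign_of_not_injective
  intro hinj
  have h1 : Function.Injective (Fin.append (fun i => S'.orderEmbOfFin hS' i)
      fun t => Sᶜ.orderEmbOfFin (card_compl_eq h S hS) t) :=
    (Function.Injective.of_comp_iff' _ (finCongr h.symm).bijective).mp hinj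
  obtain ⟨-, -, hdis⟩ := Fin.append_injective_iff.mp h1
  apply hne
  refine Finset.eq_of_subset_of_card_le (fun x hx => ?_) (by rw [hS, hS'])
  by_contra hxS
  obtain ⟨t, ht⟩ : x ∈ Set.range (Sᶜ.orderEmbOfFin (card_compl_eq h S hS)) := by
    rw [Finset.range_orderEmbOfFin]; exact Finset.mem_coe.mpr (Finset.mem_compl.mpr hxS)
  obtain ⟨i, hi⟩ : x ∈ Set.range (S'.orderEmbOfFin hS') := by
    rw [Finset.range_orderEmbOfFin]; exact Finset.mem_coe.mpr hx
  exact hdis i t (hi.trans ht.symm)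

/-- The sorted rows are linearly independent. [cite: Nisan1991Noncommutative, §4] -/
theorem linearIndependent_sortedRow {n a b : ℕ} (h : a + b = n) :
    LinearIndependent F fun S : {S : Finset (Fin n) // S.card = a} =>
      sortedRow (F := F) a b h S.1 S.2 := by
  rw [linearIndependent_iff']
  intro s g hsum S hS
  have key := congr_fun hsum (fun t => S.1ᶜ.orderEmbOfFin (card_compl_eq h S.1 S.2) t)
  rw [Finset.sum_apply, Pi.zero_apply,
    Finset.sum_eq_single S (fun S' _ hS'S => ?_) (fun hS' => absurd hS hS')] at key
  · rw [Pi.smul_apply, smul_eq_mul] at key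
    exact (mul_eq_zero.mp key).resolve_right (sortedRow_self h S.1 S.2)
  · have hne : S'.1 ≠ S.1 := fun e => hS'S (Subtype.ext e)
    rw [Pi.smul_apply, smul_eq_mul, sortedRow_other h S.1 S'.1 S.2 S'.2 hne, mul_zero]

/-! ## §4 Rank and nc-ABP width of the ordered determinant -/

/-- NISAN'S MATRIX OF THE DETERMINANT HAS RANK EXACTLY `C(n,a)` at the cut `a | b` — the same as the
permanent's. [cite: Nisan1991Noncommutative, Thm 1, §4] -/
theorem rank_wordFlattening_detWord {n a b : ℕ} (h : a + b = n) :
    (wordFlattening (detWord F n) a b h).rank = n.choose a := by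
  have hspan : Submodule.span F (Set.range (wordFlattening (detWord F n) a b h).row) =
      Submodule.span F (Set.range fun S : {S : Finset (Fin n) // S.card = a} =>
        sortedRow (F := F) a b h S.1 S.2) := by
    apply le_antisymm
    · refine Submodule.span_le.mpr ?_
      rintro _ ⟨u, rfl⟩
      exact row_mem_span h u
    · refine Submodule.span_le.mpr ?_
      rintro _ ⟨S, rfl⟩
      exact Submodule.subset_span ⟨fun i => S.1.orderEmbOfFin S.2 i, rfl⟩
  rw [Matrix.rank_eq_finrank_span_row, hspan,
    finrank_span_eq_card (linearIndependent_sortedRow h), Fintype.card_finset_len,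
    Fintype.card_fin]

/-- THE DECIDED LEVEL IS `VP`-BLIND: the ordered DETERMINANT has a noncommutative ABP of width `≤ w` iff
`C(n,⌊n/2⌋) ≤ w` — exactly as the ordered permanent (`NisanPermanent.hasNcABPWidthLE_perWord_iff`).
[cite: Nisan1991Noncommutative, Thm 1, §4; BlaserDorflerIkenmeyer2020, Prop 12] -/
theorem hasNcABPWidthLE_detWord_iff (n w : ℕ) :
    BDI2020.HasNcABPWidthLE w (detWord F n) ↔ n.choose (n / 2) ≤ w := by
  rw [BDI2020.hasNcABPWidthLE_iff_wordTTRank_le, wordTTRank_le_iff]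
  constructor
  · intro H
    have := H (n / 2) (n - n / 2) (by omega)
    rwa [rank_wordFlattening_detWord] at this
  · intro hw a b h
    rw [rank_wordFlattening_detWord]
    exact (Nat.choose_le_middle a n).trans hw

/-- Corollary: `ncAbpWidth (detWord F n) = C(n,⌊n/2⌋) = ncAbpWidth (perWord F n)`.
[cite: Nisan1991Noncommutative, Thm 1, §4] -/
theorem ncAbpWidth_detWord (n : ℕ) :
    BDI2020.ncAbpWidth (detWord F n) = n.choose (n / 2) ∧
      BDI2020.ncAbpWidth (detWord F n) = BDI2020.ncAbpWidth (perWord F n) := by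
  have h1 : BDI2020.ncAbpWidth (detWord F n) = n.choose (n / 2) := by
    apply le_antisymm
    · exact BDI2020.ncAbpWidth_le ((hasNcABPWidthLE_detWord_iff n _).mpr le_rfl)
    · exact le_csInf ⟨_, (hasNcABPWidthLE_detWord_iff n _).mpr le_rfl⟩
        fun w hw => (hasNcABPWidthLE_detWord_iff n w).mp hw
  exact ⟨h1, h1.trans (ncAbpWidth_perWord n).symm⟩

end Summit.ValiantsHypothesis.ValiantsHypothesis.Theorems.NisanDeterminant
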